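import Mathlib
import Literature.MathematicalPhysics.QuantumFieldTheory.OSReconstructionNoE1Proofs
import Literature.MathematicalPhysics.QuantumFieldTheory.OSVectorNormGrowth
import HarnessLib

/-!
# One-gap stretching: temperedness bounds and continuity of the stretched test functions

Crux `MirrorModularBoosts.PlanarSpectralCone` (stmt-QuantumFields-9664), line
`positivity-disc-to-operator-cone`, stub `stub_oneGap` (density half), PART A′: estimates.

For time-translated blocks of tensor products the Schwartz norms grow polynomially in the
translation parameter (`|X(· - w)|_M ≤ 2^M (1+‖w‖)^M 2|X|_M`), tensor products and OS adjoints are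
bounded on Schwartz norms (`OSVectorNormGrowth`), and every component `𝔖ₙ` of a Schwinger family is
bounded by one Schwartz norm (temperedness E0, `SchwingerFamily.exists_bound_holds`). Consequences
proved here, for a `k`-point `P`, an `l`-point `Q` and the stretched pair
`F(s) = P ⊗ Q_{s e₀}`:

* `schwartzNorm_translateMulti_le`, `schwartzNorm_stretch_le`: `|Q_{se₀}|_M`, `|F(s)|_M` grow like
  `(1+|s|)^M`;
* `exists_norm_kernel_le`: `|𝔖(ΘF(s)* ⊗ F(s'))| ≤ C ((1+|s|)(1+|s'|))^p` (the Gram kernel);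
* `exists_norm_recentre_sq_le`: `|𝔖(ΘR(σ)* ⊗ R(σ))| ≤ C (1+|σ|)^p` for the re-centred block
  `R(σ) = (ΘP* ⊗ F(σ))_{+Te₀}` (the squared norm of its field vector);
* `continuous_stretch`, `continuous_kernelTest`: `s ↦ F(s)` and `(s,s') ↦ ΘF(s)* ⊗ F(s')` are
  continuous into `𝓢` (strong continuity of translations on Schwartz space).

References: Osterwalder–Schrader, CMP 31 (1973) §4.1 (4.8); CMP 42 (1975) Ch. VI.1. No definitions.
-/

noncomputable section

namespace Summit.QuantumFields.YangMills.Cruxes.PlanarSpectralCone.PositivityDiscToOperatorCone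

open MeasureTheory Complex Set Filter
open scoped InnerProductSpace SchwartzMap ComplexConjugate Topology
open Literature.MathematicalPhysics.QuantumLattice Literature.MathematicalPhysics.AQFT
  Literature.MathematicalPhysics.QuantumFieldTheory

namespace OneGap

/-! ### Schwartz norms of translates and of the stretched pair -/

/-- `|F_{a}|_M ≤ 2^M (1 + ‖a‖)^M · 2 |F|_M` for a diagonal translate of an `n`-point test function. -/
theorem schwartzNorm_translateMulti_le {n : ℕ} (M : ℕ) (a : EuclideanSpace ℝ (Fin 4))
    (F : 𝓢((Fin n → EuclideanSpace ℝ (Fin 4)), ℂ)) :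
    schwartzNorm M (translateMulti a F) ≤ 2 ^ M * (1 + ‖a‖) ^ M * (2 * schwartzNorm M F) := by
  have h1 := SchwingerFamily.schwartzNorm_compSubConstCLM_le M (fun _ : Fin n => a) F
  have hw : ‖(fun _ : Fin n => a)‖ ≤ ‖a‖ := by
    refine (pi_norm_le_iff_of_nonneg (norm_nonneg a)).2 fun _ => le_rfl
  have h2 : (2 : ℝ) ^ M * (1 + ‖(fun _ : Fin n => a)‖) ^ M * (2 * schwartzNorm M F) ≤
      2 ^ M * (1 + ‖a‖) ^ M * (2 * schwartzNorm M F) := by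
    have := schwartzNorm_nonneg M F
    gcongr
  exact h1.trans h2

/-- `‖timeVec s‖ = |s|`. -/
theorem norm_timeVec (s : ℝ) : ‖(SchwingerFamily.timeVec (d := 4) s : EuclideanSpace ℝ (Fin 4))‖ = |s| := by
  simp [SchwingerFamily.timeVec]

/-- **Polynomial growth of the stretched pair**: `|P ⊗ Q_{se₀}|_M ≤ A (1+|s|)^M` with
`A = 2^{M+1} |P|_M 2^M 2 |Q|_M`. -/
theorem schwartzNorm_stretch_le {k l : ℕ} (M : ℕ) (P : 𝓢((Fin k → EuclideanSpace ℝ (Fin 4)), ℂ))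
    (Q : 𝓢((Fin l → EuclideanSpace ℝ (Fin 4)), ℂ)) (s : ℝ) :
    schwartzNorm M (P.appendTensor (translateMulti (SchwingerFamily.timeVec s) Q)) ≤
      (2 ^ (M + 1) * schwartzNorm M P * (2 ^ M * (2 * schwartzNorm M Q))) * (1 + |s|) ^ M := by
  have hP := schwartzNorm_nonneg M P
  have hQ := schwartzNorm_nonneg M Q
  calc schwartzNorm M (P.appendTensor (translateMulti (SchwingerFamily.timeVec s) Q))
      ≤ 2 ^ (M + 1) * schwartzNorm M P * schwartzNorm M (translateMulti (SchwingerFamily.timeVec s) Q) :=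
        schwartzNorm_appendTensor_le _ _ _
    _ ≤ 2 ^ (M + 1) * schwartzNorm M P * (2 ^ M * (1 + |s|) ^ M * (2 * schwartzNorm M Q)) := by
        have h := schwartzNorm_translateMulti_le M (SchwingerFamily.timeVec s) Q
        rw [norm_timeVec] at h
        exact mul_le_mul_of_nonneg_left h (by positivity)
    _ = (2 ^ (M + 1) * schwartzNorm M P * (2 ^ M * (2 * schwartzNorm M Q))) * (1 + |s|) ^ M := by ring

/-! ### Temperedness: the Gram kernel and the re-centred block grow polynomially -/

/-- **The pairing is tempered**: `|𝔖_{a+b}(ΘA* ⊗ B)| ≤ |C₀| 2^{M+1} |A|_M |B|_M` where `(M, C₀)`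
is the E0 bound of the single distribution `𝔖_{a+b}`. -/
theorem norm_apply_osAdjoint_appendTensor_le (S : SchwingerFamily (EuclideanSpace ℝ (Fin 4)))
    {a b : ℕ} {M : ℕ} {C₀ : ℝ}
    (hS : ∀ F : 𝓢((Fin (a + b) → EuclideanSpace ℝ (Fin 4)), ℂ), ‖S (a + b) F‖ ≤ C₀ * schwartzNorm M F)
    (A : 𝓢((Fin a → EuclideanSpace ℝ (Fin 4)), ℂ)) (B : 𝓢((Fin b → EuclideanSpace ℝ (Fin 4)), ℂ)) :
    ‖S (a + b) ((osAdjoint A).appendTensor B)‖ ≤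
      |C₀| * (2 ^ (M + 1) * schwartzNorm M A * schwartzNorm M B) := by
  have hA := schwartzNorm_nonneg M A
  have hB := schwartzNorm_nonneg M B
  calc ‖S (a + b) ((osAdjoint A).appendTensor B)‖
      ≤ C₀ * schwartzNorm M ((osAdjoint A).appendTensor B) := hS _
    _ ≤ |C₀| * schwartzNorm M ((osAdjoint A).appendTensor B) :=
        mul_le_mul_of_nonneg_right (le_abs_self _) (schwartzNorm_nonneg _ _)
    _ ≤ |C₀| * (2 ^ (M + 1) * schwartzNorm M (osAdjoint A) * schwartzNorm M B) :=
        mul_le_mul_of_nonneg_left (schwartzNorm_appendTensor_le _ _ _) (abs_nonneg _)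
    _ ≤ |C₀| * (2 ^ (M + 1) * schwartzNorm M A * schwartzNorm M B) := by
        gcongr
        exact schwartzNorm_osAdjoint_le A M

/-- **The Gram kernel of the stretched pair is polynomially bounded**:
`|𝔖(Θ(P⊗Q_{se₀})* ⊗ (P⊗Q_{s'e₀}))| ≤ C ((1+|s|)(1+|s'|))^p` for all real `s, s'`. -/
theorem exists_norm_kernel_le (S : SchwingerFamily (EuclideanSpace ℝ (Fin 4))) {k l : ℕ}
    (P : 𝓢((Fin k → EuclideanSpace ℝ (Fin 4)), ℂ)) (Q : 𝓢((Fin l → EuclideanSpace ℝ (Fin 4)), ℂ)) :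
    ∃ (C : ℝ) (p : ℕ), 0 ≤ C ∧ ∀ s s' : ℝ,
      ‖S ((k + l) + (k + l)) ((osAdjoint (P.appendTensor (translateMulti (SchwingerFamily.timeVec s) Q))).appendTensor
        (P.appendTensor (translateMulti (SchwingerFamily.timeVec s') Q)))‖ ≤
        C * ((1 + |s|) * (1 + |s'|)) ^ p := by
  obtain ⟨M, C₀, hS⟩ := SchwingerFamily.exists_bound_holds S ((k + l) + (k + l))
  set A : ℝ := 2 ^ (M + 1) * schwartzNorm M P * (2 ^ M * (2 * schwartzNorm M Q)) with hA
  have hA0 : 0 ≤ A := by have := schwartzNorm_nonneg M P; have := schwartzNorm_nonneg M Q; positivity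
  refine ⟨|C₀| * (2 ^ (M + 1) * A * A), M, by positivity, fun s s' => ?_⟩
  refine (norm_apply_osAdjoint_appendTensor_le S hS _ _).trans ?_
  have h1 := schwartzNorm_stretch_le M P Q s
  have h2 := schwartzNorm_stretch_le M P Q s'
  have hs : (0 : ℝ) ≤ (1 + |s|) ^ M := by positivity
  have hs' : (0 : ℝ) ≤ (1 + |s'|) ^ M := by positivity
  have h12 : schwartzNorm M (P.appendTensor (translateMulti (SchwingerFamily.timeVec s) Q)) *
      schwartzNorm M (P.appendTensor (translateMulti (SchwingerFamily.timeVec s') Q)) ≤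
      (A * (1 + |s|) ^ M) * (A * (1 + |s'|) ^ M) :=
    mul_le_mul h1 h2 (schwartzNorm_nonneg _ _) (by positivity)
  calc |C₀| * (2 ^ (M + 1) * schwartzNorm M (P.appendTensor (translateMulti (SchwingerFamily.timeVec s) Q)) *
        schwartzNorm M (P.appendTensor (translateMulti (SchwingerFamily.timeVec s') Q)))
      ≤ |C₀| * (2 ^ (M + 1) * ((A * (1 + |s|) ^ M) * (A * (1 + |s'|) ^ M))) := by
        rw [mul_assoc (2 ^ (M + 1) : ℝ)]
        exact mul_le_mul_of_nonneg_left (mul_le_mul_of_nonneg_left h12 (by positivity)) (abs_nonneg _)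
    _ = |C₀| * (2 ^ (M + 1) * A * A) * ((1 + |s|) * (1 + |s'|)) ^ M := by rw [mul_pow]; ring

/-- **The re-centred block is polynomially bounded in norm squared**:
`|𝔖(ΘR(σ)* ⊗ R(σ))| ≤ C (1+|σ|)^p`, `R(σ) = (ΘP* ⊗ (P ⊗ Q_{σe₀}))_{+Te₀}`. -/
theorem exists_norm_recentre_sq_le (S : SchwingerFamily (EuclideanSpace ℝ (Fin 4))) {k l : ℕ}
    (P : 𝓢((Fin k → EuclideanSpace ℝ (Fin 4)), ℂ)) (Q : 𝓢((Fin l → EuclideanSpace ℝ (Fin 4)), ℂ)) (T : ℝ) :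
    ∃ (C : ℝ) (p : ℕ), 0 ≤ C ∧ ∀ σ : ℝ,
      ‖S ((k + (k + l)) + (k + (k + l)))
        ((osAdjoint (translateMulti (SchwingerFamily.timeVec T)
          ((osAdjoint P).appendTensor (P.appendTensor (translateMulti (SchwingerFamily.timeVec σ) Q))))).appendTensor
          (translateMulti (SchwingerFamily.timeVec T)
            ((osAdjoint P).appendTensor (P.appendTensor (translateMulti (SchwingerFamily.timeVec σ) Q)))))‖ ≤
        C * (1 + |σ|) ^ p := by
  obtain ⟨M, C₀, hS⟩ := SchwingerFamily.exists_bound_holds S ((k + (k + l)) + (k + (k + l)))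
  set A : ℝ := 2 ^ (M + 1) * schwartzNorm M P * (2 ^ M * (2 * schwartzNorm M Q)) with hA
  have hA0 : 0 ≤ A := by have := schwartzNorm_nonneg M P; have := schwartzNorm_nonneg M Q; positivity
  -- `|R(σ)|_M ≤ B (1+|σ|)^M`
  set B : ℝ := 2 ^ M * (1 + |T|) ^ M * (2 * (2 ^ (M + 1) * schwartzNorm M P * A)) with hB
  have hB0 : 0 ≤ B := by have := schwartzNorm_nonneg M P; positivity
  have hR : ∀ σ : ℝ, schwartzNorm M (translateMulti (SchwingerFamily.timeVec T)
      ((osAdjoint P).appendTensor (P.appendTensor (translateMulti (SchwingerFamily.timeVec σ) Q)))) ≤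
      B * (1 + |σ|) ^ M := by
    intro σ
    have h1 := schwartzNorm_translateMulti_le M (SchwingerFamily.timeVec T)
      ((osAdjoint P).appendTensor (P.appendTensor (translateMulti (SchwingerFamily.timeVec σ) Q)))
    rw [norm_timeVec] at h1
    have hP := schwartzNorm_nonneg M P
    have hY : schwartzNorm M ((osAdjoint P).appendTensor
        (P.appendTensor (translateMulti (SchwingerFamily.timeVec σ) Q))) ≤
        2 ^ (M + 1) * schwartzNorm M P * (A * (1 + |σ|) ^ M) := by
      refine (schwartzNorm_appendTensor_le _ _ _).trans ?_
      refine mul_le_mul ?_ (schwartzNorm_stretch_le M P Q σ) (schwartzNorm_nonneg _ _) (by positivity)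
      exact mul_le_mul_of_nonneg_left (schwartzNorm_osAdjoint_le P M) (by positivity)
    refine h1.trans ?_
    calc 2 ^ M * (1 + |T|) ^ M * (2 * schwartzNorm M ((osAdjoint P).appendTensor
          (P.appendTensor (translateMulti (SchwingerFamily.timeVec σ) Q))))
        ≤ 2 ^ M * (1 + |T|) ^ M * (2 * (2 ^ (M + 1) * schwartzNorm M P * (A * (1 + |σ|) ^ M))) :=
          mul_le_mul_of_nonneg_left (mul_le_mul_of_nonneg_left hY (by norm_num)) (by positivity)
      _ = B * (1 + |σ|) ^ M := by ring
  refine ⟨|C₀| * (2 ^ (M + 1) * B * B), M + M, by positivity, fun σ => ?_⟩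
  refine (norm_apply_osAdjoint_appendTensor_le S hS _ _).trans ?_
  have h1 := hR σ
  have hσ : (0 : ℝ) ≤ (1 + |σ|) ^ M := by positivity
  have h0 : (0 : ℝ) ≤ schwartzNorm M (translateMulti (SchwingerFamily.timeVec T)
      ((osAdjoint P).appendTensor (P.appendTensor (translateMulti (SchwingerFamily.timeVec σ) Q)))) :=
    schwartzNorm_nonneg _ _
  have h11 : schwartzNorm M (translateMulti (SchwingerFamily.timeVec T)
          ((osAdjoint P).appendTensor (P.appendTensor (translateMulti (SchwingerFamily.timeVec σ) Q)))) *
        schwartzNorm M (translateMulti (SchwingerFamily.timeVec T)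
          ((osAdjoint P).appendTensor (P.appendTensor (translateMulti (SchwingerFamily.timeVec σ) Q)))) ≤
      (B * (1 + |σ|) ^ M) * (B * (1 + |σ|) ^ M) :=
    mul_le_mul h1 h1 h0 (by positivity)
  calc |C₀| * (2 ^ (M + 1) * schwartzNorm M (translateMulti (SchwingerFamily.timeVec T)
          ((osAdjoint P).appendTensor (P.appendTensor (translateMulti (SchwingerFamily.timeVec σ) Q)))) *
        schwartzNorm M (translateMulti (SchwingerFamily.timeVec T)
          ((osAdjoint P).appendTensor (P.appendTensor (translateMulti (SchwingerFamily.timeVec σ) Q)))))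
      ≤ |C₀| * (2 ^ (M + 1) * ((B * (1 + |σ|) ^ M) * (B * (1 + |σ|) ^ M))) := by
        rw [mul_assoc (2 ^ (M + 1) : ℝ)]
        exact mul_le_mul_of_nonneg_left (mul_le_mul_of_nonneg_left h11 (by positivity)) (abs_nonneg _)
    _ = |C₀| * (2 ^ (M + 1) * B * B) * (1 + |σ|) ^ (M + M) := by rw [pow_add]; ring

/-! ### Continuity of the stretched test functions -/

/-- `t ↦ timeVec t` is continuous. -/
theorem continuous_timeVec : Continuous fun t : ℝ => (SchwingerFamily.timeVec (d := 4) t : EuclideanSpace ℝ (Fin 4)) := by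
  change Continuous fun t : ℝ => WithLp.toLp 2 (Pi.single (M := fun _ : Fin 4 => ℝ) 0 t)
  exact (PiLp.continuous_toLp 2 _).comp (continuous_single (A := fun _ : Fin 4 => ℝ) 0 :)

/-- **Strong continuity of the stretching**: `s ↦ P ⊗ Q_{se₀}` is continuous into `𝓢`. -/
theorem continuous_stretch {k l : ℕ} (P : 𝓢((Fin k → EuclideanSpace ℝ (Fin 4)), ℂ))
    (Q : 𝓢((Fin l → EuclideanSpace ℝ (Fin 4)), ℂ)) :
    Continuous fun s : ℝ => P.appendTensor (translateMulti (SchwingerFamily.timeVec s) Q) := by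
  have hQ : Continuous fun s : ℝ => translateMulti (SchwingerFamily.timeVec (d := 4) s) Q := by
    have h1 := continuous_compSubConstCLM (𝕜 := ℂ) Q
    have h2 : Continuous fun s : ℝ => (fun _ : Fin l => (SchwingerFamily.timeVec (d := 4) s : EuclideanSpace ℝ (Fin 4))) :=
      continuous_pi fun _ => continuous_timeVec
    exact h1.comp h2
  exact continuous_appendTensor.comp (continuous_const.prodMk hQ)

/-- **Joint continuity of the kernel test function**: `u ↦ Θ(P⊗Q_{u₀e₀})* ⊗ (P⊗Q_{u₁e₀})` is continuous
from `Fin 2 → ℝ` into `𝓢`. -/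
theorem continuous_kernelTest {k l : ℕ} (P : 𝓢((Fin k → EuclideanSpace ℝ (Fin 4)), ℂ))
    (Q : 𝓢((Fin l → EuclideanSpace ℝ (Fin 4)), ℂ)) :
    Continuous fun u : Fin 2 → ℝ =>
      (osAdjoint (P.appendTensor (translateMulti (SchwingerFamily.timeVec (u 0)) Q))).appendTensor
        (P.appendTensor (translateMulti (SchwingerFamily.timeVec (u 1)) Q)) := by
  have h0 : Continuous fun u : Fin 2 → ℝ => P.appendTensor (translateMulti (SchwingerFamily.timeVec (u 0)) Q) :=
    (continuous_stretch P Q).comp (continuous_apply 0)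
  have h1 : Continuous fun u : Fin 2 → ℝ => P.appendTensor (translateMulti (SchwingerFamily.timeVec (u 1)) Q) :=
    (continuous_stretch P Q).comp (continuous_apply 1)
  exact continuous_appendTensor.comp ((continuous_osAdjoint.comp h0).prodMk h1)

end OneGap

end Summit.QuantumFields.YangMills.Cruxes.PlanarSpectralCone.PositivityDiscToOperatorCone
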